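import Mathlib
import HarnessLib
import Summits.ValiantsHypothesis.ValiantsHypothesis.Theorems.EquivariantDialLayersToy

/-!
# EquivariantDialLayersToyTransfer — window cuts of `per_m` restrict to toy cuts of `e_m`

The bridge that makes `Theorems.EquivariantDialLayersToy` bear on the census leaf
`R^lay = IdealWidthSuperpoly biPermSubst` (cell `A^lay`, W36): the DIAGONAL RESTRICTION
`x_{ij} ↦ δ_{ij} y_i` (`diagStar`) is an algebra map sending `per_m` to `e_m(y) = y₁ ⋯ y_m`
(`diagStar_perPoly`), intertwining the diagonal bi-permutations `(π, π)` of the window group with the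
permutations of `y` (`diagStar_rename_prodCongr`), and preserving degree-`d` forms.  Hence every
`biPermSubst`-stable degree-`d` cut of `per_m` by `r` forms restricts to a `permSubst`-stable degree-`d`
cut of `e_m` by at most `r` forms:

  `HasIdealWidthLE (biPermSubst m) per_m d r → HasIdealWidthLE (permSubst (Fin m) ℂ) (∏ i, X i) d r`
                                                            (`hasIdealWidthLE_prod_X_of_perPoly`),

so `idealWidth (permSubst (Fin m) ℂ) e_m d ≤ idealWidth (biPermSubst m) per_m d` whenever the window
width is attained (`idealWidth_toy_le_window`).  Read contrapositively: a lower bound for the window's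
ideal width obtained THROUGH the diagonal restriction is a lower bound for the toy width, which
`idealWidth_toy_le` caps at `m(d+1)+1` — transfer-type instruments cannot witness `R^lay`
(lens 1, g15; calibration kernel, no item closed).
-/

namespace Summit.ValiantsHypothesis.ValiantsHypothesis.Theorems.EquivariantDialLayersToy

open MvPolynomial Finset Literature.Computability.AlgebraicComplexity
open Summit.ValiantsHypothesis.ValiantsHypothesis.Theorems.EquivariantDialLayers
open Summit.ValiantsHypothesis.ValiantsHypothesis.Theorems.EquivariantDialNode

noncomputable section

variable {m : ℕ}

/-- The diagonal restriction `x_{ij} ↦ δ_{ij} y_i` as a `ℂ`-algebra map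
`ℂ[x_{ij} : i, j < m] → ℂ[y_i : i < m]`. -/
def diagStar (m : ℕ) : MvPolynomial (Fin m × Fin m) ℂ →ₐ[ℂ] MvPolynomial (Fin m) ℂ :=
  aeval fun ij => if ij.1 = ij.2 then X ij.1 else 0

/-- The diagonal restriction on variables: `x_{ij} ↦ δ_{ij} y_i`. -/
@[simp] theorem diagStar_X (i j : Fin m) :
    diagStar m (X (i, j)) = if i = j then X i else 0 := by
  simp [diagStar]

/-- The images of the variables are linear forms (or zero). -/
theorem diagStar_X_isHomogeneous (ij : Fin m × Fin m) :
    ((fun ij : Fin m × Fin m => if ij.1 = ij.2 then (X ij.1 : MvPolynomial (Fin m) ℂ) else 0) ij).IsHomogeneous 1 := by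
  dsimp only
  split_ifs
  · exact isHomogeneous_X _ _
  · exact isHomogeneous_zero _ _ _

/-- The diagonal restriction preserves degree-`d` forms. -/
theorem isHomogeneous_diagStar {p : MvPolynomial (Fin m × Fin m) ℂ} {d : ℕ} (hp : p.IsHomogeneous d) :
    (diagStar m p).IsHomogeneous d := by
  have h := hp.aeval _ diagStar_X_isHomogeneous
  rw [one_mul] at h
  exact h

/-- The diagonal restriction of the permanent is the product of the diagonal variables:
`per(diag(y)) = y₁ ⋯ y_m` (only the identity permutation survives). -/
theorem diagStar_perPoly : diagStar m (perPoly (Fin m) ℂ) = ∏ i, X i := by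
  simp only [perPoly, Matrix.permanent, Matrix.mvPolynomialX_apply, map_sum, map_prod, diagStar_X]
  rw [Finset.sum_eq_single 1]
  · simp
  · intro π _ hπ
    obtain ⟨i, hi⟩ : ∃ i, π i ≠ i := by
      by_contra h
      exact hπ (Equiv.ext fun i => not_not.1 fun hi => h ⟨i, hi⟩)
    exact Finset.prod_eq_zero (Finset.mem_univ i) (if_neg hi)
  · intro h
    exact absurd (Finset.mem_univ _) h

/-- The diagonal restriction intertwines the diagonal bi-permutation renaming `(Q, Q)` of the matrix
variables with the renaming `Q` of the diagonal variables. -/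
theorem diagStar_rename_prodCongr (Q : Equiv.Perm (Fin m)) (p : MvPolynomial (Fin m × Fin m) ℂ) :
    diagStar m (rename (Equiv.prodCongr Q Q) p) = rename Q (diagStar m p) := by
  have h : (diagStar m).comp (rename (Equiv.prodCongr Q Q)) = (rename Q).comp (diagStar m) := by
    refine MvPolynomial.algHom_ext fun ij => ?_
    obtain ⟨i, j⟩ := ij
    simp only [AlgHom.comp_apply, rename_X, Equiv.prodCongr_apply, Prod.map, diagStar_X,
      Q.injective.eq_iff]
    split_ifs <;> simp
  exact congrArg (fun f => f p) (congrArg (fun f : _ →ₐ[ℂ] _ => (f : _ → _)) h)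

/-- The diagonal bi-permutation `(P, P)` is (the matrix of) an element of the window group. -/
theorem exists_mem_biPermSubst_prodCongr (P : Equiv.Perm (Fin m)) :
    ∃ γ ∈ biPermSubst m, (γ : Matrix (Fin m × Fin m) (Fin m × Fin m) ℂ) =
      Equiv.Perm.permMatrix ℂ (Equiv.prodCongr P P) := by
  obtain ⟨γ, -, hγ⟩ := permMatrix_mem_permSubst (k := ℂ) (σ := Fin m × Fin m) (Equiv.prodCongr P P)
  exact ⟨γ, Subgroup.subset_closure ⟨P, P, hγ⟩, hγ⟩

/-- **Window cuts restrict to toy cuts.**  A `biPermSubst`-stable cut of `per_m` in degree `d` by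
`r` forms restricts, under `x ↦ diag(y)`, to a `permSubst`-stable cut of `e_m = y₁ ⋯ y_m` in degree `d`
by at most `r` forms. -/
theorem hasIdealWidthLE_prod_X_of_perPoly {d r : ℕ}
    (h : HasIdealWidthLE (biPermSubst m) (perPoly (Fin m) ℂ) d r) :
    HasIdealWidthLE (permSubst (Fin m) ℂ) (∏ i : Fin m, X i : MvPolynomial (Fin m) ℂ) d r := by
  classical
  obtain ⟨s, hcard, hhom, hstab, hmem⟩ := h
  refine ⟨s.image (diagStar m), card_image_le.trans hcard, ?_, ?_, ?_⟩
  · intro p hp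
    obtain ⟨q, hq, rfl⟩ := mem_image.1 hp
    exact isHomogeneous_diagStar (hhom q hq)
  · intro γ hγ p hp
    obtain ⟨q, hq, rfl⟩ := mem_image.1 hp
    obtain ⟨P, hP⟩ := exists_permMatrix_of_mem_permSubst hγ
    obtain ⟨γ', hγ', hγ'P⟩ := exists_mem_biPermSubst_prodCongr (m := m) P
    have hq' := hstab γ' hγ' q hq
    rw [hγ'P, linSubst_permMatrix (σ := Fin m × Fin m) (k := ℂ) (Equiv.prodCongr P P),
      Equiv.prodCongr_symm] at hq'
    have h2 : diagStar m (rename (Equiv.prodCongr P.symm P.symm) q) ∈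
        Submodule.span ℂ (diagStar m '' (s : Set (MvPolynomial (Fin m × Fin m) ℂ))) := by
      have h3 := Submodule.mem_map_of_mem (f := (diagStar m).toLinearMap) hq'
      rw [Submodule.map_span] at h3
      exact h3
    rwa [hP, linSubst_permMatrix (σ := Fin m) (k := ℂ) P, ← diagStar_rename_prodCongr, coe_image]
  · have := Ideal.mem_map_of_mem (diagStar m) hmem
    rw [Ideal.map_span, diagStar_perPoly] at this
    rwa [coe_image]

/-- **Toy width ≤ window width** whenever the window's degree-`d` cut set is nonempty (the window's
ideal width is attained): every witness of `R^lay`'s quantity dominates the toy quantity. -/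
theorem idealWidth_toy_le_window {d : ℕ}
    (h : ∃ r, HasIdealWidthLE (biPermSubst m) (perPoly (Fin m) ℂ) d r) :
    idealWidth (permSubst (Fin m) ℂ) (∏ i : Fin m, X i : MvPolynomial (Fin m) ℂ) d ≤
      idealWidth (biPermSubst m) (perPoly (Fin m) ℂ) d :=
  idealWidth_le (hasIdealWidthLE_prod_X_of_perPoly (Nat.sInf_mem h))

end

end Summit.ValiantsHypothesis.ValiantsHypothesis.Theorems.EquivariantDialLayersToy
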